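import Summits.CriticalPhenomena.PercolationContinuityZ3.Theorems.PercNearOneGluingNoHeavyLowerTailSahiAbsorbedSahiReduction
import Summits.CriticalPhenomena.PercolationContinuityZ3.Theorems.PercNearOneGluingNoHeavyLowerTailSahiAbsorbedProfile

/-!
# Sahi's conjecture lives on coloured antichains: the saturation reduction at the VALUE level, every weight, every order

Support file (cell `prim-sahi`, seat `prim-sahi-typer` gen 27; `--supports stmt-CriticalPhenomena-4575`).  Pure proofs, no
definitions, no `sorry`, standard axioms.  Value-level twin of `…SahiSlotPatternSaturation(Colouring)`.

Let `μ ≥ 0` be a weight on a finite partial order `α` that is Sahi-positive at the orders `1, …, n+1`, and let `U_0, …, U_{n+1}` be up-sets.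
By lane P3's value-level sign law (`SahiAbsorbed.sahiE_cons_insert_le_of_not_mem`: adding to a member a point lying outside some OTHER
member does not increase `E_{n+2}`), adding to `U_i` a maximal non-element that lies outside some `U_j`, `j ≠ i`, keeps a family of up-sets and does
not increase `E_{n+2}(1_{U_0}, …, 1_{U_{n+1}})`.  Iterating (`exists_saturated_le`): every family of up-sets is dominated by a SATURATED one —
every maximal non-element of each member lies in all other members — i.e. `U_i = α ∖ ↓N_i` with `N_0 ⊔ … ⊔ N_{n+1}` an ANTICHAIN of `α`
carrying an ordered `(n+2)`-colouring.  Consequences: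
* `sahiPositive_of_saturated`, `sahiPositive_of_colouring`: `C_{n+2}(μ)` follows from `C_{≤ n+1}(μ)` and `E_{n+2} ≥ 0` on the families
  `U_i = {q | ∀ p ∈ N, c p = i → ¬ q ≤ p}`, `N` an antichain, `c : α → Fin (n+2)`;
* `sahiPositive_three_of_colouring`: **Sahi's `C_3` for an FKG weight (in particular Kahn's Conjecture 5 for a product measure) is decided on
  triples of increasing events that are the complements of the down-sets generated by the three colour classes of a 3-coloured antichain**
  (a coloured Sperner family, for the Boolean lattice) — unconditionally, since `C_1, C_2` hold;
* `forall_sahiConjecture_of_colouring`: Sahi's conjecture at every order reduces to coloured antichains (strong induction on the order, as in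
  P3's `forall_sahiConjecture_of_noncontaining`, which this refines: a saturated family with all colour classes nonempty is in particular
  pairwise incomparable). [this work]
-/

namespace Summit.CriticalPhenomena.PercolationContinuityZ3.Theorems

open Finset Function Equiv
open Literature.Combinatorics.Sahi2008

namespace SahiAbsorbed

section Saturation

open scoped Classical

variable {α : Type*} [Fintype α] [PartialOrder α] {μ : α → ℝ} {n : ℕ}

/-- Reading a family through the transposition `(0 i)` exhibits its `i`-th member as the head. [this work] -/
theorem comp_swap_eq_cons {β : Type*} (f : Fin (n + 2) → β) (i : Fin (n + 2)) :
    (fun j => f (swap 0 i j)) = Fin.cons (f i) (fun k => f (swap 0 i k.succ)) := by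
  funext j
  refine Fin.cases ?_ (fun k => ?_) j
  · simp only [swap_apply_left, Fin.cons_zero]
  · simp only [Fin.cons_succ]

/-- **The sign-law step in an arbitrary slot**: for up-sets `U_j` and a point `y ∉ U_i` lying outside some other member `U_{j₀}`, adding `y` to
`U_i` does not increase `E_{n+2}` — given `C_k(μ)` for `k ≤ n+1`. [this work] -/
theorem sahiE_update_insert_le (hμ0 : ∀ x, 0 ≤ μ x) (hpos : ∀ k, 1 ≤ k → k ≤ n + 1 → SahiPositive μ k)
    (U : Fin (n + 2) → Finset α) (hU : ∀ j, IsUpperSet (U j : Set α)) (i : Fin (n + 2)) {y : α} (hyi : y ∉ U i)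
    {j₀ : Fin (n + 2)} (hj₀ : j₀ ≠ i) (hyj : y ∉ U j₀) :
    sahiE μ (n + 2) (fun j => setInd (update U i (insert y (U i)) j)) ≤ sahiE μ (n + 2) (fun j => setInd (U j)) := by
  rw [← sahiE_comp_perm μ (n + 2) (swap 0 i) (fun j => setInd (update U i (insert y (U i)) j)),
    ← sahiE_comp_perm μ (n + 2) (swap 0 i) (fun j => setInd (U j)),
    comp_swap_eq_cons (fun j => setInd (update U i (insert y (U i)) j)) i, comp_swap_eq_cons (fun j => setInd (U j)) i]
  have hne : ∀ k : Fin (n + 1), swap (0 : Fin (n + 2)) i k.succ ≠ i := by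
    intro k h
    have h2 := congrArg (swap (0 : Fin (n + 2)) i) h
    rw [swap_apply_self, swap_apply_right] at h2
    exact Fin.succ_ne_zero k h2
  have htail : (fun k : Fin (n + 1) => setInd (update U i (insert y (U i)) (swap 0 i k.succ))) =
      fun k => setInd (U (swap 0 i k.succ)) := by
    funext k; rw [update_of_ne (hne k)]
  rw [update_self, htail]
  have hj0' : swap (0 : Fin (n + 2)) i j₀ ≠ 0 := by
    intro h
    have h2 := congrArg (swap (0 : Fin (n + 2)) i) h
    rw [swap_apply_self, swap_apply_left] at h2
    exact hj₀ h2
  obtain ⟨k₀, hk₀⟩ := Fin.exists_succ_eq.2 hj0'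
  refine sahiE_cons_insert_le_of_not_mem hμ0 hpos (U i) (fun k => U (swap 0 i k.succ)) (fun k => hU _) hyi (j₀ := k₀) ?_
  rw [hk₀, swap_apply_self]
  exact hyj

/-- **SATURATION (value level)**: given `C_k(μ)` for `k ≤ n+1`, every family of `n+2` up-sets is dominated by a SATURATED family of up-sets —
slotwise larger and with no larger `E_{n+2}`; saturated: every maximal non-element of each member lies in every other member. [this work] -/
theorem exists_saturated_le (hμ0 : ∀ x, 0 ≤ μ x) (hpos : ∀ k, 1 ≤ k → k ≤ n + 1 → SahiPositive μ k)
    (U : Fin (n + 2) → Finset α) (hU : ∀ i, IsUpperSet (U i : Set α)) :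
    ∃ V : Fin (n + 2) → Finset α, (∀ i, IsUpperSet (V i : Set α)) ∧ (∀ i, U i ⊆ V i) ∧
      (∀ i j, i ≠ j → ∀ y, y ∉ V i → (∀ z, y < z → z ∈ V i) → y ∈ V j) ∧
      sahiE μ (n + 2) (fun i => setInd (V i)) ≤ sahiE μ (n + 2) (fun i => setInd (U i)) := by
  set M := (n + 2) * Fintype.card α with hM
  have hbound : ∀ W : Fin (n + 2) → Finset α, ∑ i, (W i).card ≤ M := by
    intro W
    calc ∑ i, (W i).card ≤ ∑ _i : Fin (n + 2), Fintype.card α := sum_le_sum fun i _ => card_le_univ _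
      _ = M := by rw [sum_const, card_univ, Fintype.card_fin, smul_eq_mul]
  suffices H : ∀ m (W : Fin (n + 2) → Finset α), M - ∑ i, (W i).card = m → (∀ i, IsUpperSet (W i : Set α)) →
      ∃ V : Fin (n + 2) → Finset α, (∀ i, IsUpperSet (V i : Set α)) ∧ (∀ i, W i ⊆ V i) ∧
        (∀ i j, i ≠ j → ∀ y, y ∉ V i → (∀ z, y < z → z ∈ V i) → y ∈ V j) ∧
        sahiE μ (n + 2) (fun i => setInd (V i)) ≤ sahiE μ (n + 2) (fun i => setInd (W i)) from H _ U rfl hU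
  intro m
  induction m using Nat.strong_induction_on with
  | _ m ih =>
    intro W hm hW
    by_cases hsat : ∀ i j, i ≠ j → ∀ y, y ∉ W i → (∀ z, y < z → z ∈ W i) → y ∈ W j
    · exact ⟨W, hW, fun i => Subset.rfl, hsat, le_rfl⟩
    push Not at hsat
    obtain ⟨i, j, hij, y, hyi, hymax, hyj⟩ := hsat
    set W' : Fin (n + 2) → Finset α := update W i (insert y (W i)) with hW'
    have hW'i : W' i = insert y (W i) := by rw [hW', update_self]
    have hW'k : ∀ k, k ≠ i → W' k = W k := fun k hk => by rw [hW', update_of_ne hk]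
    have hup : ∀ k, IsUpperSet (W' k : Set α) := by
      intro k
      by_cases hk : k = i
      · subst hk
        rw [hW'i]
        intro a b hab ha
        rw [mem_coe, mem_insert] at ha ⊢
        rcases ha with rfl | ha
        · rcases eq_or_lt_of_le hab with rfl | hlt
          · exact Or.inl rfl
          · exact Or.inr (hymax b hlt)
        · exact Or.inr (hW k hab ha)
      · rw [hW'k k hk]; exact hW k
    have hsub : ∀ k, W k ⊆ W' k := by
      intro k
      by_cases hk : k = i
      · subst hk; rw [hW'i]; exact subset_insert _ _
      · rw [hW'k k hk]
    have hcard : ∑ k, (W' k).card = ∑ k, (W k).card + 1 := by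
      have h1 : ∑ k, (W' k).card = ∑ k, ((W k).card + if k = i then 1 else 0) := by
        refine sum_congr rfl fun k _ => ?_
        by_cases hk : k = i
        · subst hk; rw [hW'i, card_insert_of_notMem hyi, if_pos rfl]
        · rw [hW'k k hk, if_neg hk, add_zero]
      rw [h1, sum_add_distrib, sum_ite_eq' univ i, if_pos (mem_univ _)]
    have hm' : M - ∑ k, (W' k).card < m := by
      have := hbound W'
      omega
    obtain ⟨V, hV, hWV, hVsat, hVle⟩ := ih _ hm' W' rfl hup
    refine ⟨V, hV, fun k => (hsub k).trans (hWV k), hVsat, hVle.trans ?_⟩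
    rw [hW']
    exact sahiE_update_insert_le hμ0 hpos W hW i hyi (Ne.symm hij) hyj

/-- **`C_{n+2}(μ)` from `C_{≤ n+1}(μ)` and positivity on SATURATED families of up-sets.** [this work] -/
theorem sahiPositive_of_saturated (hμ0 : ∀ x, 0 ≤ μ x) (hpos : ∀ k, 1 ≤ k → k ≤ n + 1 → SahiPositive μ k)
    (hsat : ∀ V : Fin (n + 2) → Finset α, (∀ i, IsUpperSet (V i : Set α)) →
      (∀ i j, i ≠ j → ∀ y, y ∉ V i → (∀ z, y < z → z ∈ V i) → y ∈ V j) → 0 ≤ sahiE μ (n + 2) (fun i => setInd (V i))) :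
    SahiPositive μ (n + 2) := by
  rw [sahiPositive_iff_indicators]
  intro U hU
  obtain ⟨V, hV, -, hVsat, hle⟩ := exists_saturated_le hμ0 hpos U hU
  exact (hsat V hV hVsat).trans hle

/-- Above every non-element of a finset of a finite partial order lies a maximal non-element. [this work] -/
theorem exists_maximal_notMem_ge (W : Finset α) {q : α} (hq : q ∉ W) :
    ∃ p, q ≤ p ∧ p ∉ W ∧ ∀ z, p < z → z ∈ W := by
  set S : Finset α := univ.filter fun p => q ≤ p ∧ p ∉ W with hS
  have hqS : q ∈ S := by rw [hS, mem_filter]; exact ⟨mem_univ _, le_rfl, hq⟩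
  obtain ⟨p, hpmax⟩ := S.exists_maximal ⟨q, hqS⟩
  have hpS : p ∈ S := hpmax.1
  rw [hS, mem_filter] at hpS
  refine ⟨p, hpS.2.1, hpS.2.2, fun z hz => ?_⟩
  by_contra hzW
  have hzS : z ∈ S := by rw [hS, mem_filter]; exact ⟨mem_univ _, hpS.2.1.trans (le_of_lt hz), hzW⟩
  exact absurd (hpmax.2 hzS (le_of_lt hz)) (not_le_of_gt hz)

/-- **COLOURED ANTICHAINS (value level)**: `C_{n+2}(μ)` follows from `C_{≤ n+1}(μ)` and `E_{n+2} ≥ 0` on the families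
`U_i = {q | ∀ p ∈ N, c p = i → ¬ q ≤ p}` for antichains `N ⊆ α` and colourings `c : α → Fin (n+2)`. [this work] -/
theorem sahiPositive_of_colouring (hμ0 : ∀ x, 0 ≤ μ x) (hpos : ∀ k, 1 ≤ k → k ≤ n + 1 → SahiPositive μ k)
    (h : ∀ (N : Finset α) (c : α → Fin (n + 2)), IsAntichain (· ≤ ·) (N : Set α) →
      0 ≤ sahiE μ (n + 2) (fun i => setInd (univ.filter fun q : α => ∀ p ∈ N, c p = i → ¬ q ≤ p))) :
    SahiPositive μ (n + 2) := by
  refine sahiPositive_of_saturated hμ0 hpos fun V hV hsat => ?_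
  set N : Finset α := univ.filter fun p => ∃ i, p ∉ V i ∧ ∀ z, p < z → z ∈ V i with hN
  have hc : ∀ p : α, ∃ i : Fin (n + 2), (p ∈ N → p ∉ V i ∧ ∀ z, p < z → z ∈ V i) := by
    intro p
    by_cases hp : p ∈ N
    · rw [hN, mem_filter] at hp
      obtain ⟨i, hi⟩ := hp.2
      exact ⟨i, fun _ => hi⟩
    · exact ⟨0, fun h' => (hp h').elim⟩
  choose c hcspec using hc
  have huniq : ∀ {p : α} {i i' : Fin (n + 2)}, p ∉ V i → (∀ z, p < z → z ∈ V i) → p ∉ V i' → i = i' := by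
    intro p i i' hi himax hi'
    by_contra hne
    exact hi' (hsat i i' hne p hi himax)
  have hVeq : (fun i => setInd (univ.filter fun q : α => ∀ p ∈ N, c p = i → ¬ q ≤ p)) = fun i => setInd (V i) := by
    funext i
    congr 1
    ext q
    rw [mem_filter]
    constructor
    · rintro ⟨-, hq⟩
      by_contra hqV
      obtain ⟨p, hqp, hpV, hpmax⟩ := exists_maximal_notMem_ge (V i) hqV
      have hpN : p ∈ N := by rw [hN, mem_filter]; exact ⟨mem_univ _, i, hpV, hpmax⟩
      exact hq p hpN (huniq (hcspec p hpN).1 (hcspec p hpN).2 hpV) hqp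
    · intro hq
      refine ⟨mem_univ _, fun p hpN hpi hqp => ?_⟩
      have hpV : p ∉ V (c p) := (hcspec p hpN).1
      rw [hpi] at hpV
      exact hpV (hV i hqp hq)
  have hanti : IsAntichain (· ≤ ·) (N : Set α) := by
    intro p hp p' hp' hne hle
    rw [mem_coe] at hp hp'
    have h1 := hcspec p hp
    have h2 := hcspec p' hp'
    have hlt : p < p' := lt_of_le_of_ne hle hne
    by_cases hcc : c p = c p'
    · have : p' ∈ V (c p) := h1.2 p' hlt
      rw [hcc] at this
      exact h2.1 this
    · exact h2.1 (hV (c p') hle (hsat (c p) (c p') hcc p h1.1 h1.2))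
  have := h N c hanti
  rwa [hVeq] at this

end Saturation

section Consequences

open scoped Classical

/-- **SAHI'S `C_3` IS DECIDED ON 3-COLOURED ANTICHAINS** (every FKG weight on a finite distributive lattice; for a product measure on a
Boolean lattice this is Kahn's Conjecture 5 restricted to triples of increasing events co-generated by a 3-coloured Sperner family):
unconditional, since `C_1` and `C_2` hold. [this work] -/
theorem sahiPositive_three_of_colouring {α : Type*} [Fintype α] [DistribLattice α] {μ : α → ℝ} (hμ : IsFKGMeasure μ)
    (h : ∀ (N : Finset α) (c : α → Fin 3), IsAntichain (· ≤ ·) (N : Set α) →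
      0 ≤ sahiE μ 3 (fun i => setInd (univ.filter fun q : α => ∀ p ∈ N, c p = i → ¬ q ≤ p))) :
    SahiPositive μ 3 := by
  refine sahiPositive_of_colouring (n := 1) hμ.nonneg (fun k hk1 hk2 => ?_) h
  interval_cases k
  · exact sahiPositive_one hμ.nonneg
  · exact sahiPositive_two hμ

/-- **SAHI'S CONJECTURE REDUCES TO COLOURED ANTICHAINS, AT EVERY ORDER**: if for every `n`, every FKG weight on every finite distributive
lattice and every `(n+2)`-coloured antichain the co-generated family has `E_{n+2} ≥ 0`, then `C_n` holds for all `n`. [this work] -/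
theorem forall_sahiConjecture_of_colouring
    (hcore : ∀ (n : ℕ) (α : Type) [DistribLattice α] [Fintype α] (μ : α → ℝ), IsFKGMeasure μ →
      ∀ (N : Finset α) (c : α → Fin (n + 2)), IsAntichain (· ≤ ·) (N : Set α) →
        0 ≤ sahiE μ (n + 2) (fun i => setInd (univ.filter fun q : α => ∀ p ∈ N, c p = i → ¬ q ≤ p))) :
    ∀ n, SahiConjecture n := by
  intro n
  induction n using Nat.strong_induction_on with
  | _ n ih =>
    match n, ih with
    | 0, _ => exact sahiConjecture_zero
    | 1, _ => exact fun α _ _ μ hμ => sahiPositive_one hμ.nonneg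
    | m + 2, ih =>
      intro α _ _ μ hμ
      exact sahiPositive_of_colouring hμ.nonneg (fun k hk1 hk2 => ih k (by omega) α μ hμ) (hcore m α μ hμ)

/-- **Inductive form**: the prover of the coloured-antichain core at order `n+2` may assume all lower orders of Sahi's conjecture. [this work] -/
theorem forall_sahiConjecture_of_colouring'
    (hcore : ∀ (n : ℕ), (∀ k, k ≤ n + 1 → SahiConjecture k) →
      ∀ (α : Type) [DistribLattice α] [Fintype α] (μ : α → ℝ), IsFKGMeasure μ →
      ∀ (N : Finset α) (c : α → Fin (n + 2)), IsAntichain (· ≤ ·) (N : Set α) →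
        0 ≤ sahiE μ (n + 2) (fun i => setInd (univ.filter fun q : α => ∀ p ∈ N, c p = i → ¬ q ≤ p))) :
    ∀ n, SahiConjecture n := by
  intro n
  induction n using Nat.strong_induction_on with
  | _ n ih =>
    match n, ih with
    | 0, _ => exact sahiConjecture_zero
    | 1, _ => exact fun α _ _ μ hμ => sahiPositive_one hμ.nonneg
    | m + 2, ih =>
      intro α _ _ μ hμ
      exact sahiPositive_of_colouring hμ.nonneg (fun k hk1 hk2 => ih k (by omega) α μ hμ)
        (hcore m (fun k hk => ih k (by omega)) α μ hμ)

end Consequences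

end SahiAbsorbed

end Summit.CriticalPhenomena.PercolationContinuityZ3.Theorems
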